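import Literature.Computability.AlgebraicComplexity.AndrewsForbes2022Thm38Proofs

/-!
# Andrews–Forbes 2022, Theorem 4.4 and Corollary 4.5 from Proposition 4.2 (Pfaffian hardness)

`AndrewsForbes2022_thm_4_4_of_prop_4_2 : AndrewsForbes2022_prop_4_2 → AndrewsForbes2022_thm_4_4`:
the Pfaffian analogue of Theorem 3.8 (characteristic zero) is PROVED from Proposition 4.2 (the
reduction of a nonzero `f ∈ I^Pf_{2n,2r}` to a single standard monomial `[K_σ]`, which rests on
Pfaffian straightening and stays a named fact), following the printed proof (p0027:L100–p0028:L45)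
with the machinery of `AndrewsForbes2022Thm38Proofs.lean`: the skew-symmetric matrix of Lemma 4.3
is taken to be `M = Lemma43.ilM (Theorem38.extMat A n n)` (the interleaved double of `A ⊕ I`,
sign `+`), so that `[K_σ](M) = ∏ᵢ Pf(M_{[σᵢ]}) = (det A)^t = (1 + ĝ)^t` with
`t = #{i : σᵢ ≥ 2r} ≥ 1` (`Theorem44.bind₁_kPfaffMonomial_ilM_extMat`); the linear forms are the
entries of `P X Pᵀ` (`skewCongr`); everything else (old `ε ↦ ε^{D+1}`, `y ↦ εy`, `z ↦ ε`,
binomial remainder, top gate, oracle replacement) is as for Thm. 3.8.  Consequently Cor. 4.5 is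
conditional only on Prop. 4.2 and a Pfaffian layered ABP with `c t³` vertices
(`AndrewsForbes2022_cor_4_5_of_prop_4_2`).  No new named facts.

Honest framing: glue between typed literature items; VP ≠ VNP is NOT proved.

## References
* [AndrewsForbes2022] R. Andrews, M. A. Forbes, STOC 2022, arXiv:2112.00792 — Prop. 4.2,
  Lemma 4.3, Thm. 4.4, Cor. 4.5 (§4.2, pp. 26–28).
-/

noncomputable section

open MvPolynomial Matrix
open scoped RatFunc LaurentSeries Polynomial

namespace Literature.Computability.AlgebraicComplexity

namespace Theorem44

open Theorem38 Lemma43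

/-! #### The generic skew-symmetric matrix under maps and substitutions -/

/-- Proof step of Thm. 4.4 (`skewX_map`). [cite: AndrewsForbes2022, Thm. 4.4 (proof)] -/
theorem skewX_map {R S : Type*} [CommRing R] [CommRing S] (f : R →+* S) (k : ℕ) :
    (skewX R k).map (MvPolynomial.map f) = skewX S k := by
  ext i j
  simp only [Matrix.map_apply, skewX, Matrix.of_apply]
  split_ifs <;> simp

/-- Substituting the entries of a skew-symmetric matrix with zero diagonal for the variables of the
generic skew-symmetric matrix gives that matrix back. [cite: AndrewsForbes2022, Thm. 4.4 (proof)] -/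
theorem skewX_map_bind₁ {S : Type*} [CommRing S] {τ : Type*} {k : ℕ}
    (M : Matrix (Fin k) (Fin k) (MvPolynomial τ S)) (hM : Mᵀ = -M) (hd : ∀ i, M i i = 0) :
    (skewX S k).map (MvPolynomial.bind₁ fun p : SkewVarIdx k => M p.1.1 p.1.2) = M := by
  ext i j
  simp only [Matrix.map_apply, skewX, Matrix.of_apply]
  split_ifs with h1 h2
  · simp
  · have : M i j = -M j i := by
      have := congrFun (congrFun hM j) i
      simpa [Matrix.transpose_apply] using this
    simp [this]
  · have hij : i = j := le_antisymm (not_lt.mp h2) (not_lt.mp h1)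
    subst hij
    simp [hd]

/-- Proof step of Thm. 4.4 (`map_leadingPfaffian`). [cite: AndrewsForbes2022, Thm. 4.4 (proof)] -/
theorem map_leadingPfaffian {R S : Type*} [CommRing R] [CommRing S] (f : R →+* S) (k s : ℕ) :
    MvPolynomial.map f (leadingPfaffian R k s) = leadingPfaffian S k s := by
  unfold leadingPfaffian
  split_ifs with h
  · rw [pfaffian_eq_matrixPfaffian, pfaffian_eq_matrixPfaffian,
      ← Literature.LinearAlgebra.Matrix.pfaffian_map, ← Matrix.submatrix_map, skewX_map]
  · simp

/-- Proof step of Thm. 4.4 (`map_kPfaffMonomial`). [cite: AndrewsForbes2022, Thm. 4.4 (proof)] -/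
theorem map_kPfaffMonomial {R S : Type*} [CommRing R] [CommRing S] (f : R →+* S) (k : ℕ)
    (σ : Multiset ℕ) : MvPolynomial.map f (kPfaffMonomial R k σ) = kPfaffMonomial S k σ := by
  unfold kPfaffMonomial
  rw [map_multiset_prod, Multiset.map_map]
  congr 1
  exact Multiset.map_congr rfl fun s _ => map_leadingPfaffian f k s

/-- Proof step of Thm. 4.4 (`kPfaffMonomial_cons`). [cite: AndrewsForbes2022, Thm. 4.4 (proof)] -/
theorem kPfaffMonomial_cons {R : Type*} [CommRing R] (k s : ℕ) (σ : Multiset ℕ) :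
    kPfaffMonomial R k (s ::ₘ σ) = leadingPfaffian R k s * kPfaffMonomial R k σ := by
  simp [kPfaffMonomial]

/-- Proof step of Thm. 4.4 (`bind₁_leadingPfaffian`). [cite: AndrewsForbes2022, Thm. 4.4 (proof)] -/
theorem bind₁_leadingPfaffian {S : Type*} [CommRing S] {τ : Type*} {k : ℕ}
    (M : Matrix (Fin k) (Fin k) (MvPolynomial τ S)) (hM : Mᵀ = -M) (hd : ∀ i, M i i = 0)
    {s : ℕ} (hs : s ≤ k) :
    MvPolynomial.bind₁ (fun p : SkewVarIdx k => M p.1.1 p.1.2) (leadingPfaffian S k s) =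
      pfaffian s (M.submatrix (Fin.castLE hs) (Fin.castLE hs)) := by
  have hmap := Literature.LinearAlgebra.Matrix.pfaffian_map
    (MvPolynomial.bind₁ fun p : SkewVarIdx k => M p.1.1 p.1.2 :
      MvPolynomial (SkewVarIdx k) S →ₐ[S] MvPolynomial τ S).toRingHom
    ((skewX S k).submatrix (Fin.castLE hs) (Fin.castLE hs))
  rw [AlgHom.toRingHom_eq_coe, RingHom.coe_coe] at hmap
  rw [leadingPfaffian, dif_pos hs, pfaffian_eq_matrixPfaffian, pfaffian_eq_matrixPfaffian, ← hmap,
    ← Matrix.submatrix_map, skewX_map_bind₁ M hM hd]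

/-! #### The skew matrix `M = P((0, A ⊕ I), (-(A ⊕ I)ᵀ, 0))Pᵀ` of Lemma 4.3 and `[K_σ](M)` -/

/-- Proof step of Thm. 4.4 (`ilM_map`). [cite: AndrewsForbes2022, Thm. 4.4 (proof)] -/
theorem ilM_map {S T : Type*} [CommRing S] [CommRing T] {n : ℕ} (f : S →+* T)
    (B : Matrix (Fin n) (Fin n) S) : (ilM B).map f = ilM (B.map f) := by
  unfold ilM dbl
  rw [Matrix.reindex_apply, Matrix.reindex_apply, ← Matrix.submatrix_map, Matrix.fromBlocks_map]
  congr 2 <;> simp [Matrix.transpose_map, Matrix.map_neg]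

/-- Proof step of Thm. 4.4 (`ilM_entry_cases`). [cite: AndrewsForbes2022, Thm. 4.4 (proof)] -/
theorem ilM_entry_cases {S : Type*} [CommRing S] {n : ℕ} (B : Matrix (Fin n) (Fin n) S)
    (i j : Fin (2 * n)) :
    ilM B i j = 0 ∨ (∃ a b, ilM B i j = B a b) ∨ (∃ a b, ilM B i j = -B a b) := by
  unfold ilM dbl
  rw [Matrix.reindex_apply, Matrix.submatrix_apply]
  rcases (ilv n).symm i with a | a <;> rcases (ilv n).symm j with b | b
  · left; simp
  · right; left; exact ⟨a, b, by simp⟩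
  · right; right; exact ⟨b, a, by simp⟩
  · left; simp

/-- `[K_σ]` at `M`: `∏ᵢ Pf(M_{[σᵢ]}) = (det A)^t`, `t = #{i : σᵢ ≥ 2r}` (p0028:L1–L20). [cite: AndrewsForbes2022, Thm. 4.4 (proof)] -/
theorem bind₁_kPfaffMonomial_ilM_extMat {L : Type*} [Field L] {τ : Type*} {r n : ℕ}
    (A : Matrix (Fin r) (Fin r) (MvPolynomial τ L))
    (hA : ∀ (k : ℕ) (hk : k < r), (A.submatrix (Fin.castLE hk.le) (Fin.castLE hk.le)).det = 1)
    (σ : Multiset ℕ) (hσ : ∀ s ∈ σ, Even s ∧ 0 < s ∧ s ≤ 2 * n) :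
    MvPolynomial.bind₁ (fun p : SkewVarIdx (2 * n) => ilM (extMat A n n) p.1.1 p.1.2)
        (kPfaffMonomial L (2 * n) σ) =
      A.det ^ Multiset.card (σ.filter fun s => 2 * r ≤ s) := by
  induction σ using Multiset.induction_on with
  | empty => simp
  | cons s σ ih =>
    obtain ⟨hse, -, hs2n⟩ := hσ s (Multiset.mem_cons_self s σ)
    obtain ⟨k, hk⟩ := hse
    have hsk : s = 2 * k := by omega
    subst hsk
    have hkn : k ≤ n := by omega
    rw [kPfaffMonomial_cons, map_mul, ih fun s' hs' => hσ s' (Multiset.mem_cons_of_mem hs'),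
      bind₁_leadingPfaffian _ (ilM_transpose _) (ilM_apply_self _) (Nat.mul_le_mul_left 2 hkn),
      ilM_submatrix_castLE _ hkn, pfaffian_eq_matrixPfaffian, pfaffian_ilM, Multiset.filter_cons]
    by_cases hrk : r ≤ k
    · rw [if_pos (by omega), det_extMat_submatrix_of_ge A hrk hkn hkn, Multiset.singleton_add,
        Multiset.card_cons, pow_succ, mul_comm]
    · rw [if_neg (by omega), zero_add, extMat_submatrix_of_le A (Nat.le_of_not_le hrk) hkn hkn,
        hA k (Nat.lt_of_not_le hrk), one_mul]

/-! #### Entries of `P X Pᵀ` -/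

/-- Proof step of Thm. 4.4 (`totalDegree_conj_le`). [cite: AndrewsForbes2022, Thm. 4.4 (proof)] -/
theorem totalDegree_conj_le {S : Type*} [CommRing S] {τ : Type*} {k : ℕ}
    (P : Matrix (Fin k) (Fin k) S) (N : Matrix (Fin k) (Fin k) (MvPolynomial τ S))
    (hN : ∀ a b, (N a b).totalDegree ≤ 1) (i j : Fin k) :
    ((P.map (C : S →+* MvPolynomial τ S) * N * (P.map (C : S →+* MvPolynomial τ S))ᵀ) i j).totalDegree ≤ 1 := by
  rw [Matrix.mul_apply]
  refine (totalDegree_finsetSum _ _).trans (Finset.sup_le fun b _ => ?_)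
  rw [Matrix.mul_apply, Matrix.transpose_apply, Matrix.map_apply]
  refine (totalDegree_mul _ _).trans ?_
  rw [totalDegree_C, add_zero]
  refine (totalDegree_finsetSum _ _).trans (Finset.sup_le fun a _ => ?_)
  rw [Matrix.map_apply]
  refine (totalDegree_mul _ _).trans ?_
  rw [totalDegree_C, zero_add]
  exact hN a b

/-- Proof step of Thm. 4.4 (`totalDegree_skewX_le`). [cite: AndrewsForbes2022, Thm. 4.4 (proof)] -/
theorem totalDegree_skewX_le {S : Type*} [CommRing S] (k : ℕ) (a b : Fin k) :
    (skewX S k a b).totalDegree ≤ 1 := by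
  simp only [skewX, Matrix.of_apply]
  split_ifs
  · by_cases h : Nontrivial S
    · exact (totalDegree_X (R := S) _).le
    · have : Subsingleton S := not_nontrivial_iff_subsingleton.mp h
      rw [Subsingleton.elim (X _ : MvPolynomial (SkewVarIdx k) S) 0, totalDegree_zero]
      exact Nat.zero_le _
  · rw [totalDegree_neg]
    by_cases h : Nontrivial S
    · exact (totalDegree_X (R := S) _).le
    · have : Subsingleton S := not_nontrivial_iff_subsingleton.mp h
      rw [Subsingleton.elim (X _ : MvPolynomial (SkewVarIdx k) S) 0, totalDegree_zero]
      exact Nat.zero_le _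
  · rw [totalDegree_zero]; exact Nat.zero_le _

variable {F : Type*} [Field F]

/-- Proof step of Thm. 4.4 (`polyOrdGE_conj`). [cite: AndrewsForbes2022, Thm. 4.4 (proof)] -/
theorem polyOrdGE_conj {τ : Type*} {k : ℕ} {e : ℕ} (P : Matrix (Fin k) (Fin k) (LaurentSeries F))
    (hP : ∀ i j, IsOrdGE (-(e : ℤ)) (P i j))
    (N : Matrix (Fin k) (Fin k) (MvPolynomial τ (LaurentSeries F))) (hN : ∀ a b, PolyOrdGE 0 (N a b))
    (i j : Fin k) : PolyOrdGE (-((2 * e : ℕ) : ℤ))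
      ((P.map (C : LaurentSeries F →+* MvPolynomial τ (LaurentSeries F)) * N *
        (P.map (C : LaurentSeries F →+* MvPolynomial τ (LaurentSeries F)))ᵀ) i j) := by
  rw [Matrix.mul_apply]
  refine PolyOrdGE.sum fun b _ => ?_
  rw [Matrix.mul_apply, Matrix.transpose_apply, Matrix.map_apply]
  have h1 : PolyOrdGE (-(e : ℤ)) (∑ a, (P.map (C : LaurentSeries F →+* MvPolynomial τ (LaurentSeries F))) i a * N a b) := by
    refine PolyOrdGE.sum fun a _ => ?_
    rw [Matrix.map_apply]
    simpa using (PolyOrdGE.C (hP i a)).mul (hN a b)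
  have := h1.mul (PolyOrdGE.C (σ := τ) (hP j b))
  convert this using 1
  push_cast; ring

/-- Proof step of Thm. 4.4 (`polyOrdGE_zero_skewX`). [cite: AndrewsForbes2022, Thm. 4.4 (proof)] -/
theorem polyOrdGE_zero_skewX (k : ℕ) (a b : Fin k) :
    PolyOrdGE 0 (skewX (LaurentSeries F) k a b : MvPolynomial (SkewVarIdx k) (LaurentSeries F)) := by
  simp only [skewX, Matrix.of_apply]
  split_ifs
  · exact PolyOrdGE.X _
  · exact (PolyOrdGE.X _).neg
  · exact PolyOrdGE.zero 0

/-- Proof step of Thm. 4.4 (`polyOrdGE_zero_ilM`). [cite: AndrewsForbes2022, Thm. 4.4 (proof)] -/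
theorem polyOrdGE_zero_ilM {ι : Type*} {n : ℕ} (B : Matrix (Fin n) (Fin n) (MvPolynomial ι (LaurentSeries F)))
    (hB : ∀ a b, PolyOrdGE 0 (B a b)) (i j : Fin (2 * n)) : PolyOrdGE 0 (ilM B i j) := by
  rcases ilM_entry_cases B i j with h | ⟨a, b, h⟩ | ⟨a, b, h⟩
  · rw [h]; exact PolyOrdGE.zero 0
  · rw [h]; exact hB a b
  · rw [h]; exact (hB a b).neg

/-- Proof step of Thm. 4.4 (`totalDegree_ilM_le`). [cite: AndrewsForbes2022, Thm. 4.4 (proof)] -/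
theorem totalDegree_ilM_le {S : Type*} [CommRing S] {τ : Type*} {n : ℕ}
    (B : Matrix (Fin n) (Fin n) (MvPolynomial τ S)) (hB : ∀ a b, (B a b).totalDegree ≤ 1)
    (i j : Fin (2 * n)) : (ilM B i j).totalDegree ≤ 1 := by
  rcases ilM_entry_cases B i j with h | ⟨a, b, h⟩ | ⟨a, b, h⟩
  · rw [h, totalDegree_zero]; exact Nat.zero_le _
  · rw [h]; exact hB a b
  · rw [h, totalDegree_neg]; exact hB a b

/-- Proof step of Thm. 4.4 (`pfaffIdeal_eq_bot`). [cite: AndrewsForbes2022, Thm. 4.4 (proof)] -/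
theorem pfaffIdeal_eq_bot {n r : ℕ} (h : n < r) : pfaffIdeal F n r = ⊥ := by
  rw [pfaffIdeal, Ideal.span_eq_bot]
  rintro p ⟨ρ, rfl⟩
  exfalso
  have := Fintype.card_le_of_embedding ρ.toEmbedding
  simp at this
  omega

end Theorem44


/-! #### Theorem 4.4 from Proposition 4.2 -/

set_option maxHeartbeats 1600000 in
open Theorem38 Lemma43 Theorem44 in
/-- **Theorem 4.4 (characteristic zero) follows from Proposition 4.2**, by the printed proof
(p0027:L100–p0028:L45): as for Thm. 3.8, with the skew-symmetric matrix `M` of Lemma 4.3 built on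
`A ⊕ I` (`Lemma43.ilM (Theorem38.extMat A n n)`, sign `+`) in place of `A ⊕ I`, so that
`[K_σ](M) = (det A)^t = (1 + ĝ)^t` with `t = #{i : σᵢ ≥ 2r}`. Prop. 4.2 (Pfaffian straightening)
is the only ingredient that is not a theorem of the tree. [cite: AndrewsForbes2022, Thm. 4.4 (proof)] -/
theorem AndrewsForbes2022_thm_4_4_of_prop_4_2 (h42 : AndrewsForbes2022_prop_4_2) :
    AndrewsForbes2022_thm_4_4 := by
  intro F _ _ n r f hf hf0 h hh ι g hg
  classical
  obtain ⟨g', hg'abp, hg'g⟩ := hg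
  rcases Nat.eq_zero_or_pos r with hr0 | hr0
  · subst hr0; exact absurd hg'abp (not_layeredABPComputes_zero g')
  by_cases hrn : r ≤ n
  swap
  · exfalso; apply hf0
    have := hf
    rwa [pfaffIdeal_eq_bot (Nat.lt_of_not_le hrn), Ideal.mem_bot] at this
  obtain ⟨ĝ, D, hĝhom, hĝabp, hĝg'⟩ :=
    AndrewsForbes2022_lemma_3_7_holds (Polynomial F) ι r g' hg'abp
  obtain ⟨A, hAdeg, hAdet, hAmin⟩ :=
    AndrewsForbes2022_lemma_3_6_holds (Polynomial F) (Option ι) r ĝ hĝabp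
  -- the constant case `D = 0`
  rcases Nat.eq_zero_or_pos D with hD0 | hDpos
  · subst hD0
    have hĝC : ĝ = C (coeff 0 ĝ) := by
      by_cases hz : ĝ = 0
      · rw [hz]; simp
      · exact totalDegree_eq_zero_iff_eq_C.mp (hĝhom.totalDegree hz)
    have hg'C : g' = C (coeff 0 ĝ) := by
      rw [← hĝg']
      conv_lhs => rw [hĝC]
      rw [aeval_C, MvPolynomial.algebraMap_eq]
    have hgC : g = C ((coeff 0 ĝ).coeff 0) := by
      rw [← hg'g, hg'C, map_C, Polynomial.constantCoeff_apply]
    refine ⟨0, fun _ => 0, 0, algebraMap F (RatFunc F) ((coeff 0 ĝ).coeff 0),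
      fun _ => by rw [totalDegree_zero]; exact Nat.zero_le _, ?_⟩
    rw [hgC, map_C, map_zero, C_0, zero_mul, zero_add,
      show algebraMap (RatFunc F) (LaurentSeries F) (algebraMap F (RatFunc F) ((coeff 0 ĝ).coeff 0)) =
        algebraMap F (LaurentSeries F) ((coeff 0 ĝ).coeff 0) from by
          rw [← RingHom.comp_apply, algebraMap_ratFunc_comp_algebraMap], sub_self]
    exact PolyOrdGE.zero 1
  -- Proposition 4.2
  obtain ⟨P, q, α, σ, -, hα, hrσ, hσ, h35⟩ := h42 F n r hr0 hrn f hf hf0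
  obtain ⟨t, ht⟩ : ∃ t : ℕ, t = Multiset.card (σ.filter fun s => 2 * r ≤ s) := ⟨_, rfl⟩
  have htpos : 0 < t := by
    rw [ht, Multiset.card_pos, Ne, Multiset.filter_eq_nil]
    intro hall
    have : σ.sup ≤ 2 * r - 1 := Multiset.sup_le.mpr fun b hb => by
      have := hall b hb; omega
    omega
  have htF : (t : F) ≠ 0 := Nat.cast_ne_zero.mpr htpos.ne'
  -- ring homomorphisms: old `ε ↦ ε^{D+1}`
  obtain ⟨φL, hφL⟩ : ∃ φL : F[X] →+* LaurentSeries F,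
      φL = (epsPow F D).comp (algebraMap F[X] (LaurentSeries F)) := ⟨_, rfl⟩
  obtain ⟨φK, hφK⟩ : ∃ φK : F[X] →+* RatFunc F,
      φK = (algebraMap F[X] (RatFunc F)).comp
        ((Polynomial.expand F (D + 1) : F[X] →ₐ[F] F[X]) : F[X] →+* F[X]) := ⟨_, rfl⟩
  obtain ⟨ψ, hψ⟩ : ∃ ψ : RatFunc F →+* LaurentSeries F,
      ψ = (epsPow F D).comp (algebraMap (RatFunc F) (LaurentSeries F)) := ⟨_, rfl⟩
  have hKL : (algebraMap (RatFunc F) (LaurentSeries F)).comp φK = φL := by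
    refine RingHom.ext fun p => ?_
    rw [hφK, hφL]
    simp only [RingHom.coe_comp, RingHom.coe_coe, Function.comp_apply]
    rw [← IsScalarTower.algebraMap_apply, algebraMap_expand]
  have hψF : ψ.comp (algebraMap F (RatFunc F)) = algebraMap F (LaurentSeries F) := by
    refine RingHom.ext fun a => ?_
    rw [hψ]
    simp only [RingHom.coe_comp, Function.comp_apply]
    rw [show algebraMap (RatFunc F) (LaurentSeries F) (algebraMap F (RatFunc F) a) =
      HahnSeries.C a from coe_ratFunc_algebraMap a, epsPow_C, algebraMap_laurentSeries_apply]
  have hψexp : ∀ x : RatFunc F, algebraMap (RatFunc F) (LaurentSeries F) (ratFuncExpand D x) = ψ x := by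
    intro x; rw [hψ]; exact coe_ratFuncExpand D x
  -- the matrices `A`, `M` over `F(ε)` and `F((ε))` (old `ε` expanded)
  obtain ⟨AK, hAK⟩ : ∃ AK : Matrix (Fin r) (Fin r) (MvPolynomial (Option ι) (RatFunc F)),
      AK = A.map (MvPolynomial.map φK) := ⟨_, rfl⟩
  obtain ⟨AL, hAL⟩ : ∃ AL : Matrix (Fin r) (Fin r) (MvPolynomial (Option ι) (LaurentSeries F)),
      AL = A.map (MvPolynomial.map φL) := ⟨_, rfl⟩
  have hAKL : AK.map (MvPolynomial.map (algebraMap (RatFunc F) (LaurentSeries F))) = AL := by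
    rw [hAK, hAL, Matrix.map_map]
    congr 1
    funext p
    rw [Function.comp_apply, MvPolynomial.map_map, hKL]
  have hALdet : AL.det = 1 + MvPolynomial.map φL ĝ := by
    rw [hAL, ← RingHom.mapMatrix_apply, ← RingHom.map_det, hAdet, map_add, map_one]
  have hALmin : ∀ (k : ℕ) (hk : k < r),
      (AL.submatrix (Fin.castLE hk.le) (Fin.castLE hk.le)).det = 1 := by
    intro k hk
    rw [hAL, Matrix.submatrix_map, ← RingHom.mapMatrix_apply, ← RingHom.map_det, hAmin k hk,
      map_one]
  obtain ⟨MK, hMK⟩ : ∃ MK : Matrix (Fin (2 * n)) (Fin (2 * n)) (MvPolynomial (Option ι) (RatFunc F)),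
      MK = ilM (extMat AK n n) := ⟨_, rfl⟩
  obtain ⟨ML, hML⟩ : ∃ ML : Matrix (Fin (2 * n)) (Fin (2 * n)) (MvPolynomial (Option ι) (LaurentSeries F)),
      ML = ilM (extMat AL n n) := ⟨_, rfl⟩
  have hMKL : MK.map (MvPolynomial.map (algebraMap (RatFunc F) (LaurentSeries F))) = ML := by
    rw [hMK, hML, ilM_map, extMat_map, hAKL]
  -- the substitutions
  obtain ⟨θMK, hθMK⟩ : ∃ θ : SkewVarIdx (2 * n) → MvPolynomial (Option ι) (RatFunc F),
      θ = fun p => MK p.1.1 p.1.2 := ⟨_, rfl⟩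
  obtain ⟨θML, hθML⟩ : ∃ θ : SkewVarIdx (2 * n) → MvPolynomial (Option ι) (LaurentSeries F),
      θ = fun p => ML p.1.1 p.1.2 := ⟨_, rfl⟩
  obtain ⟨θεK, hθεK⟩ : ∃ θ : Option ι → MvPolynomial ι (RatFunc F),
      θ = fun o => C RatFunc.X * o.elim 1 X := ⟨_, rfl⟩
  obtain ⟨θεL, hθεL⟩ : ∃ θ : Option ι → MvPolynomial ι (LaurentSeries F),
      θ = fun o => C (HahnSeries.single 1 1) * o.elim 1 X := ⟨_, rfl⟩
  obtain ⟨PK, hPK⟩ : ∃ PK : Matrix (Fin (2 * n)) (Fin (2 * n)) (RatFunc F),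
      PK = P.map (ratFuncExpand D) := ⟨_, rfl⟩
  obtain ⟨PL, hPL⟩ : ∃ PL : Matrix (Fin (2 * n)) (Fin (2 * n)) (LaurentSeries F),
      PL = P.map ψ := ⟨_, rfl⟩
  obtain ⟨NK, hNK⟩ : ∃ NK : Matrix (Fin (2 * n)) (Fin (2 * n)) (MvPolynomial (SkewVarIdx (2 * n)) (RatFunc F)),
      NK = PK.map C * skewX (RatFunc F) (2 * n) * (PK.map C)ᵀ := ⟨_, rfl⟩
  obtain ⟨NL, hNL⟩ : ∃ NL : Matrix (Fin (2 * n)) (Fin (2 * n)) (MvPolynomial (SkewVarIdx (2 * n)) (LaurentSeries F)),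
      NL = PL.map C * skewX (LaurentSeries F) (2 * n) * (PL.map C)ᵀ := ⟨_, rfl⟩
  have hsk : ∀ a b, MvPolynomial.map (algebraMap (RatFunc F) (LaurentSeries F))
      (skewX (RatFunc F) (2 * n) a b) = skewX (LaurentSeries F) (2 * n) a b := fun a b => by
    rw [← Matrix.map_apply (f := MvPolynomial.map (algebraMap (RatFunc F) (LaurentSeries F)))
      (M := skewX (RatFunc F) (2 * n)), skewX_map]
  have hskψ : ∀ a b, MvPolynomial.map ψ (skewX (RatFunc F) (2 * n) a b) =
      skewX (LaurentSeries F) (2 * n) a b := fun a b => by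
    rw [← Matrix.map_apply (f := MvPolynomial.map ψ) (M := skewX (RatFunc F) (2 * n)), skewX_map]
  have hNKL : NK.map (MvPolynomial.map (algebraMap (RatFunc F) (LaurentSeries F))) = NL := by
    ext i j
    rw [Matrix.map_apply, hNK, hNL, hPK, hPL]
    simp only [Matrix.mul_apply, Matrix.transpose_apply, Matrix.map_apply, map_sum, map_mul, map_C,
      hψexp, hsk]
  have hN0 : (P.map (C : RatFunc F →+* MvPolynomial (SkewVarIdx (2 * n)) (RatFunc F)) *
      skewX (RatFunc F) (2 * n) * (P.map C)ᵀ).map (MvPolynomial.map ψ) = NL := by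
    ext i j
    rw [Matrix.map_apply, hNL, hPL]
    simp only [Matrix.mul_apply, Matrix.transpose_apply, Matrix.map_apply, map_sum, map_mul, map_C,
      hskψ]
  obtain ⟨ℓK, hℓK⟩ : ∃ ℓ : SkewVarIdx (2 * n) → MvPolynomial (SkewVarIdx (2 * n)) (RatFunc F),
      ℓ = fun ij => NK ij.1.1 ij.1.2 := ⟨_, rfl⟩
  obtain ⟨ℓL, hℓL⟩ : ∃ ℓ : SkewVarIdx (2 * n) → MvPolynomial (SkewVarIdx (2 * n)) (LaurentSeries F),
      ℓ = fun ij => NL ij.1.1 ij.1.2 := ⟨_, rfl⟩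
  have hθM : ∀ kl, MvPolynomial.map (algebraMap (RatFunc F) (LaurentSeries F)) (θMK kl) = θML kl := by
    intro kl
    rw [hθMK, hθML]
    show MvPolynomial.map _ (MK kl.1.1 kl.1.2) = ML kl.1.1 kl.1.2
    rw [← Matrix.map_apply (f := MvPolynomial.map (algebraMap (RatFunc F) (LaurentSeries F)))
      (M := MK), hMKL]
  have hθε : ∀ o, MvPolynomial.map (algebraMap (RatFunc F) (LaurentSeries F)) (θεK o) = θεL o := by
    intro o
    rw [hθεK, hθεL]
    cases o <;> simp [map_X]
  have hℓ : ∀ ij, MvPolynomial.map (algebraMap (RatFunc F) (LaurentSeries F)) (ℓK ij) = ℓL ij := by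
    intro ij
    rw [hℓK, hℓL]
    show MvPolynomial.map _ (NK ij.1.1 ij.1.2) = NL ij.1.1 ij.1.2
    rw [← Matrix.map_apply (f := MvPolynomial.map (algebraMap (RatFunc F) (LaurentSeries F)))
      (M := NK), hNKL]
  -- the circuit data
  obtain ⟨a, ha⟩ : ∃ a : SkewVarIdx (2 * n) → MvPolynomial ι (RatFunc F),
      a = fun ij => MvPolynomial.bind₁ θεK (MvPolynomial.bind₁ θMK (ℓK ij)) := ⟨_, rfl⟩
  obtain ⟨abar, habar⟩ : ∃ abar : SkewVarIdx (2 * n) → MvPolynomial ι (LaurentSeries F),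
      abar = fun ij => MvPolynomial.bind₁ θεL (MvPolynomial.bind₁ θML (ℓL ij)) := ⟨_, rfl⟩
  have haL : ∀ ij, MvPolynomial.map (algebraMap (RatFunc F) (LaurentSeries F)) (a ij) = abar ij := by
    intro ij
    rw [ha, habar]
    simp only [map_bind₁, hθε, hθM, hℓ]
  -- orders of the pole of the bottom gates
  obtain ⟨e, he⟩ := IsOrdGE.exists_neg_nat_forall
    (fun p : Fin (2 * n) × Fin (2 * n) => ((P p.1 p.2 : RatFunc F) : LaurentSeries F))
  have hAL0 : ∀ i j, PolyOrdGE 0 (AL i j) := by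
    intro i j
    rw [hAL, Matrix.map_apply, hφL, ← MvPolynomial.map_map]
    simpa using (polyOrdGE_zero_map_polynomial (A i j)).map_epsPow D
  have hθML0 : ∀ kl, PolyOrdGE 0 (θML kl) := by
    intro kl
    rw [hθML]
    show PolyOrdGE 0 (ML kl.1.1 kl.1.2)
    rw [hML]
    exact polyOrdGE_zero_ilM _ (fun a b => polyOrdGE_zero_extMat AL hAL0 n n a b) _ _
  have hθεL0 : ∀ o, PolyOrdGE 0 (θεL o) := by
    intro o
    have h1 : PolyOrdGE 1 (C (HahnSeries.single 1 (1 : F)) : MvPolynomial ι (LaurentSeries F)) :=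
      PolyOrdGE.C (IsOrdGE.single 1 1)
    rw [hθεL]
    cases o with
    | none => simpa using h1.mono (by norm_num)
    | some i => simpa using (h1.mul (PolyOrdGE.X i)).mono (by norm_num)
  have hPL : ∀ i j, IsOrdGE (-(((D + 1) * e : ℕ) : ℤ)) (PL i j) := by
    intro i j
    rw [hPL, Matrix.map_apply, hψ, RingHom.comp_apply]
    have := (he (i, j)).epsPow D
    convert this using 1
    push_cast; ring
  have habar_ord : ∀ ij, PolyOrdGE (-((2 * ((D + 1) * e) : ℕ) : ℤ)) (abar ij) := by
    intro ij
    rw [habar]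
    refine PolyOrdGE.bind₁ (PolyOrdGE.bind₁ ?_ hθML0) hθεL0
    rw [hℓL]
    show PolyOrdGE _ (NL ij.1.1 ij.1.2)
    rw [hNL]
    exact polyOrdGE_conj PL hPL _ (polyOrdGE_zero_skewX (2 * n)) _ _
  -- degrees of the bottom gates
  have hadeg : ∀ ij, (a ij).totalDegree ≤ 1 := by
    intro ij
    rw [ha]
    refine (totalDegree_bind₁_le_of_le_one θεK (fun o => ?_) _).trans
      ((totalDegree_bind₁_le_of_le_one θMK (fun kl => ?_) _).trans ?_)
    · rw [hθεK]
      cases o with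
      | none => simp [totalDegree_C]
      | some i =>
        refine (totalDegree_mul _ _).trans ?_
        simp [totalDegree_C, totalDegree_X]
    · rw [hθMK]
      show (MK kl.1.1 kl.1.2).totalDegree ≤ 1
      rw [hMK]
      refine totalDegree_ilM_le _ (fun a' b' => totalDegree_extMat_le AK (fun i j => ?_) n n a' b') _ _
      rw [hAK, Matrix.map_apply]
      exact (totalDegree_map_le' _ _).trans (hAdeg i j)
    · rw [hℓK]
      show (NK ij.1.1 ij.1.2).totalDegree ≤ 1
      rw [hNK]
      exact totalDegree_conj_le PK _ (totalDegree_skewX_le (2 * n)) _ _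
  -- the exponents and the top gate
  obtain ⟨Q, hQ⟩ : ∃ Q : ℤ, Q = ((D : ℤ) + 1) * q := ⟨_, rfl⟩
  obtain ⟨fbar, hfbar⟩ : ∃ fbar : MvPolynomial (SkewVarIdx (2 * n)) (LaurentSeries F),
      fbar = MvPolynomial.map (algebraMap F (LaurentSeries F)) f := ⟨_, rfl⟩
  obtain ⟨gbar, hgbar⟩ : ∃ gbar : MvPolynomial ι (LaurentSeries F),
      gbar = MvPolynomial.map (algebraMap F (LaurentSeries F)) g := ⟨_, rfl⟩
  obtain ⟨Dh, hDh⟩ : ∃ Dh : ℕ, Dh = (h - fbar).totalDegree := ⟨_, rfl⟩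
  obtain ⟨N, hN⟩ : ∃ N : ℕ, N = (Q + D).toNat + (2 * ((D + 1) * e)) * Dh := ⟨_, rfl⟩
  obtain ⟨u, hu⟩ : ∃ u : RatFunc F,
      u = (RatFunc.X ^ (Q + D) * algebraMap F (RatFunc F) (α * t))⁻¹ := ⟨_, rfl⟩
  obtain ⟨v, hv⟩ : ∃ v : RatFunc F,
      v = -(RatFunc.X ^ (D : ℤ) * algebraMap F (RatFunc F) (t : F))⁻¹ := ⟨_, rfl⟩
  refine ⟨N, a, u, v, hadeg, ?_⟩
  obtain ⟨w, hw⟩ : ∃ w : LaurentSeries F, w = HahnSeries.single (-(D : ℤ)) ((t : F)⁻¹) := ⟨_, rfl⟩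
  have hcoeX : algebraMap (RatFunc F) (LaurentSeries F) RatFunc.X = HahnSeries.single 1 1 :=
    RatFunc.coe_X
  have hubar : algebraMap (RatFunc F) (LaurentSeries F) u =
      HahnSeries.single (-(Q + D)) ((α * t : F)⁻¹) := by
    rw [hu, map_inv₀, map_mul, map_zpow₀, hcoeX, ← RatFunc.single_zpow,
      show algebraMap (RatFunc F) (LaurentSeries F) (algebraMap F (RatFunc F) (α * t)) =
        HahnSeries.C (α * t) from coe_ratFunc_algebraMap _, HahnSeries.C_apply,
      HahnSeries.single_mul_single, add_zero, one_mul, HahnSeries.inv_single]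
  have hvbar : algebraMap (RatFunc F) (LaurentSeries F) v = -w := by
    rw [hv, map_neg, map_inv₀, map_mul, map_zpow₀, hcoeX, ← RatFunc.single_zpow,
      show algebraMap (RatFunc F) (LaurentSeries F) (algebraMap F (RatFunc F) (t : F)) =
        HahnSeries.C (t : F) from coe_ratFunc_algebraMap _, HahnSeries.C_apply,
      HahnSeries.single_mul_single, add_zero, one_mul, HahnSeries.inv_single, hw]
  -- Step 1: the identity of Prop. 4.2, pushed to `F((ε))` with old `ε` expanded
  obtain ⟨ErrK, hErrK⟩ : ∃ ErrK : MvPolynomial (SkewVarIdx (2 * n)) (RatFunc F),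
      ErrK = skewCongr P f -
      C (RatFunc.X ^ q * algebraMap F (RatFunc F) α) *
        MvPolynomial.map (algebraMap F (RatFunc F)) (kPfaffMonomial F (2 * n) σ) := ⟨_, rfl⟩
  have hErr : PolyOrdGE (((D : ℤ) + 1) * (q + 1)) (MvPolynomial.map ψ ErrK) := by
    intro d
    rw [MvPolynomial.coeff_map, hψ, RingHom.comp_apply]
    have := (isBigOEps_iff_isOrdGE _ _).mp (h35 d)
    rw [← hErrK] at this
    exact this.epsPow D
  have hfℓ : MvPolynomial.map ψ (skewCongr P f) = MvPolynomial.bind₁ ℓL fbar := by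
    have hentry : ∀ ij : SkewVarIdx (2 * n), MvPolynomial.map ψ
        (((P.map (C : RatFunc F →+* MvPolynomial (SkewVarIdx (2 * n)) (RatFunc F))) *
          skewX (RatFunc F) (2 * n) *
          (P.map (C : RatFunc F →+* MvPolynomial (SkewVarIdx (2 * n)) (RatFunc F)))ᵀ :
            Matrix (Fin (2 * n)) (Fin (2 * n)) (MvPolynomial (SkewVarIdx (2 * n)) (RatFunc F)))
          ij.1.1 ij.1.2) = ℓL ij := by
      intro ij
      rw [hℓL, ← Matrix.map_apply (f := MvPolynomial.map ψ), hN0]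
    rw [skewCongr, ← MvPolynomial.aeval_map_algebraMap (RatFunc F), MvPolynomial.aeval_eq_bind₁,
      map_bind₁, MvPolynomial.map_map, hψF, hfbar]
    simp only [hentry]
  have hKσ : MvPolynomial.map ψ (C (RatFunc.X ^ q * algebraMap F (RatFunc F) α) *
      MvPolynomial.map (algebraMap F (RatFunc F)) (kPfaffMonomial F (2 * n) σ)) =
      C (HahnSeries.single Q α) * kPfaffMonomial (LaurentSeries F) (2 * n) σ := by
    rw [map_mul, map_C, MvPolynomial.map_map, hψF, map_kPfaffMonomial]
    congr 2
    rw [hψ, RingHom.comp_apply, map_mul, map_zpow₀, hcoeX, ← RatFunc.single_zpow,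
      show algebraMap (RatFunc F) (LaurentSeries F) (algebraMap F (RatFunc F) α) =
        HahnSeries.C α from coe_ratFunc_algebraMap _, map_mul, epsPow_single, epsPow_C,
      HahnSeries.C_apply, HahnSeries.single_mul_single, hQ]
    simp
  have hI1 : MvPolynomial.bind₁ ℓL fbar =
      C (HahnSeries.single Q α) * kPfaffMonomial (LaurentSeries F) (2 * n) σ +
        MvPolynomial.map ψ ErrK := by
    rw [← hfℓ, ← hKσ, hErrK, map_sub]; ring
  -- Step 2: substitute `X ↦ M`
  have hI2 : MvPolynomial.bind₁ θML (MvPolynomial.bind₁ ℓL fbar) =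
      C (HahnSeries.single Q α) * (1 + MvPolynomial.map φL ĝ) ^ t +
        MvPolynomial.bind₁ θML (MvPolynomial.map ψ ErrK) := by
    rw [hI1, map_add, map_mul, bind₁_C_right, hθML, hML,
      bind₁_kPfaffMonomial_ilM_extMat AL hALmin σ hσ, hALdet, ht]
  have hE2 : PolyOrdGE (((D : ℤ) + 1) * (q + 1))
      (MvPolynomial.bind₁ θML (MvPolynomial.map ψ ErrK)) := hErr.bind₁ hθML0
  -- Step 3: substitute `y ↦ ε y`, `z ↦ ε`
  obtain ⟨G, hG⟩ : ∃ G : MvPolynomial ι (LaurentSeries F), G = MvPolynomial.map φL g' := ⟨_, rfl⟩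
  have hGeq : MvPolynomial.bind₁ (fun o : Option ι => o.elim 1 X) (MvPolynomial.map φL ĝ) = G := by
    have hfun : (fun o : Option ι => MvPolynomial.map φL (o.elim 1 X)) =
        fun o : Option ι => (o.elim 1 X : MvPolynomial ι (LaurentSeries F)) :=
      funext fun o => by cases o <;> simp [map_X]
    rw [hG, ← hĝg', MvPolynomial.aeval_eq_bind₁, map_bind₁, hfun]
  have hscale : MvPolynomial.bind₁ θεL (MvPolynomial.map φL ĝ) =
      C (HahnSeries.single (D : ℤ) (1 : F)) * G := by
    rw [hθεL, bind₁_C_mul_of_isHomogeneous (hĝhom.map φL) (HahnSeries.single 1 1)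
      (fun o : Option ι => o.elim 1 X), hGeq, HahnSeries.single_pow]
    simp
  have habar3 : MvPolynomial.bind₁ abar fbar =
      MvPolynomial.bind₁ θεL (MvPolynomial.bind₁ θML (MvPolynomial.bind₁ ℓL fbar)) := by
    rw [habar]; simp only [bind₁_bind₁]
  have hI3 : MvPolynomial.bind₁ abar fbar =
      C (HahnSeries.single Q α) * (1 + C (HahnSeries.single (D : ℤ) (1 : F)) * G) ^ t +
        MvPolynomial.bind₁ θεL (MvPolynomial.bind₁ θML (MvPolynomial.map ψ ErrK)) := by
    rw [habar3, hI2, map_add, map_mul, bind₁_C_right, map_pow, map_add, map_one, hscale]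
  have hE3 : PolyOrdGE (((D : ℤ) + 1) * (q + 1))
      (MvPolynomial.bind₁ θεL (MvPolynomial.bind₁ θML (MvPolynomial.map ψ ErrK))) :=
    hE2.bind₁ hθεL0
  -- Step 4: `G = g + O(ε^{D+1})`, `G = O(1)`
  have hG0 : PolyOrdGE 0 G := by
    rw [hG, hφL, ← MvPolynomial.map_map]
    simpa using (polyOrdGE_zero_map_polynomial g').map_epsPow D
  have hE4 : PolyOrdGE ((D : ℤ) + 1) (G - gbar) := by
    have h1 := (polyOrdGE_one_map_polynomial_sub g').map_epsPow D
    rw [hg'g, map_sub, map_epsPow_map_algebraMap, MvPolynomial.map_map, ← hφL, ← hG, ← hgbar,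
      mul_one] at h1
    exact h1
  -- Step 5: binomial expansion
  obtain ⟨W, hW⟩ := add_pow_eq_remainder (C (HahnSeries.single (D : ℤ) (1 : F)) * G) t
  have hW0 : PolyOrdGE 0 ((W.map (Nat.castRingHom _)).eval
      (C (HahnSeries.single (D : ℤ) (1 : F)) * G)) :=
    polyOrdGE_zero_eval_natPoly W (((PolyOrdGE.C (IsOrdGE.single _ _)).mul hG0).mono (by omega))
  -- Step 6: the `f`-oracle circuit computes `g + O(ε)`
  have hs1 : HahnSeries.single (-(Q + D)) ((α * t : F)⁻¹) * HahnSeries.single Q α = w := by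
    rw [HahnSeries.single_mul_single, hw]
    congr 1
    · ring
    · field_simp
  have hs3 : w * (t : LaurentSeries F) * HahnSeries.single (D : ℤ) (1 : F) = 1 := by
    rw [hw, ← map_natCast (HahnSeries.C : F →+* LaurentSeries F) t, HahnSeries.C_apply,
      HahnSeries.single_mul_single, HahnSeries.single_mul_single, ← HahnSeries.single_zero_one]
    congr 1
    · ring
    · field_simp
  have hmain : PolyOrdGE 1
      (C (algebraMap (RatFunc F) (LaurentSeries F) u) * MvPolynomial.bind₁ abar fbar +
        C (algebraMap (RatFunc F) (LaurentSeries F) v) - gbar) := by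
    rw [hubar, hvbar, hI3, hW]
    have key : C (HahnSeries.single (-(Q + D)) ((α * t : F)⁻¹)) *
        (C (HahnSeries.single Q α) * (1 + (t : MvPolynomial ι (LaurentSeries F)) *
          (C (HahnSeries.single (D : ℤ) (1 : F)) * G) +
          (C (HahnSeries.single (D : ℤ) (1 : F)) * G) ^ 2 *
            (W.map (Nat.castRingHom _)).eval (C (HahnSeries.single (D : ℤ) (1 : F)) * G)) +
          MvPolynomial.bind₁ θεL (MvPolynomial.bind₁ θML (MvPolynomial.map ψ ErrK))) +
        C (-w) - gbar =
      (C (HahnSeries.single (-(Q + D)) ((α * t : F)⁻¹) * HahnSeries.single Q α) - C w) +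
      ((C (HahnSeries.single (-(Q + D)) ((α * t : F)⁻¹) * HahnSeries.single Q α *
          (t : LaurentSeries F) * HahnSeries.single (D : ℤ) (1 : F)) - 1) * gbar +
        C (HahnSeries.single (-(Q + D)) ((α * t : F)⁻¹) * HahnSeries.single Q α *
          (t : LaurentSeries F) * HahnSeries.single (D : ℤ) (1 : F)) * (G - gbar)) +
      C (HahnSeries.single (-(Q + D)) ((α * t : F)⁻¹) * HahnSeries.single Q α *
          HahnSeries.single (D : ℤ) (1 : F) ^ 2) *
        (G ^ 2 * (W.map (Nat.castRingHom _)).eval (C (HahnSeries.single (D : ℤ) (1 : F)) * G)) +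
      C (HahnSeries.single (-(Q + D)) ((α * t : F)⁻¹)) *
        MvPolynomial.bind₁ θεL (MvPolynomial.bind₁ θML (MvPolynomial.map ψ ErrK)) := by
      simp only [map_mul, map_neg, map_pow,
        ← map_natCast (C : LaurentSeries F →+* MvPolynomial ι (LaurentSeries F)) t]
      ring
    rw [key]
    refine ((PolyOrdGE.add ?_ ?_).add ?_).add ?_
    · rw [hs1, sub_self]; exact PolyOrdGE.zero 1
    · rw [hs1, hs3, C_1, sub_self, zero_mul, zero_add, one_mul]
      exact hE4.mono (by omega)
    · have hord : IsOrdGE (D : ℤ) (HahnSeries.single (-(Q + D)) ((α * t : F)⁻¹) *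
          HahnSeries.single Q α * HahnSeries.single (D : ℤ) (1 : F) ^ 2) := by
        rw [hs1, hw, sq, HahnSeries.single_mul_single, HahnSeries.single_mul_single]
        convert IsOrdGE.single (F := F) _ _ using 2; ring
      have := (PolyOrdGE.C hord).mul ((hG0.pow 2).mul hW0)
      exact this.mono (by simp only [add_zero]; exact_mod_cast hDpos)
    · have hord : IsOrdGE (-(Q + D)) (HahnSeries.single (-(Q + D)) ((α * t : F)⁻¹)) :=
        IsOrdGE.single _ _
      have := (PolyOrdGE.C hord).mul hE3
      have heq : -(Q + (D : ℤ)) + ((D : ℤ) + 1) * (q + 1) = 1 := by rw [hQ]; ring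
      exact this.mono heq.symm.le
  -- Step 7: replace the `f`-oracle by the `h(·, ε^{N+1})`-oracle
  have hdiff : PolyOrdGE 1 (C (algebraMap (RatFunc F) (LaurentSeries F) u) *
      MvPolynomial.bind₁ abar (MvPolynomial.map (epsPow F N) h - fbar)) := by
    have hsub : MvPolynomial.map (epsPow F N) h - fbar = MvPolynomial.map (epsPow F N) (h - fbar) := by
      rw [map_sub, hfbar, map_epsPow_map_algebraMap]
    have h1 : PolyOrdGE (((N : ℤ) + 1) * 1) (MvPolynomial.map (epsPow F N) (h - fbar)) :=
      (hfbar ▸ hh).map_epsPow N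
    have hdeg : (MvPolynomial.map (epsPow F N) (h - fbar)).totalDegree ≤ Dh := by
      rw [hDh]; exact totalDegree_map_le' _ _
    have h2 := h1.bind₁_of_totalDegree_le hdeg habar_ord
    have hord : IsOrdGE (-(Q + D)) (algebraMap (RatFunc F) (LaurentSeries F) u) := by
      rw [hubar]; exact IsOrdGE.single _ _
    rw [hsub]
    refine ((PolyOrdGE.C hord).mul h2).mono ?_
    have : Q + (D : ℤ) ≤ ((Q + D).toNat : ℤ) := Int.self_le_toNat _
    rw [hN]; push_cast; nlinarith
  -- conclusion
  have hfin := hmain.add hdiff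
  have hfun : (fun x => MvPolynomial.map (algebraMap (RatFunc F) (LaurentSeries F)) (a x)) = abar :=
    funext haL
  rw [MvPolynomial.aeval_eq_bind₁, hfun, ← hgbar]
  have heq : C (algebraMap (RatFunc F) (LaurentSeries F) u) *
        MvPolynomial.bind₁ abar (MvPolynomial.map (epsPow F N) h) +
      C (algebraMap (RatFunc F) (LaurentSeries F) v) - gbar =
      C (algebraMap (RatFunc F) (LaurentSeries F) u) * MvPolynomial.bind₁ abar fbar +
        C (algebraMap (RatFunc F) (LaurentSeries F) v) - gbar +
      C (algebraMap (RatFunc F) (LaurentSeries F) u) *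
        MvPolynomial.bind₁ abar (MvPolynomial.map (epsPow F N) h - fbar) := by
    rw [map_sub]; ring
  rw [heq]
  exact hfin

/-- Corollary 4.5 (char 0) conditional only on Prop. 4.2 and a Pfaffian layered ABP with `c t³`
vertices ([MSV04] in the printed proof). [cite: AndrewsForbes2022, Cor. 4.5 (proof)] -/
theorem AndrewsForbes2022_cor_4_5_of_prop_4_2 (h42 : AndrewsForbes2022_prop_4_2) {c : ℕ}
    (hpf : ∀ (F : Type) [Field F] (t : ℕ),
      LayeredABPComputes (c * t ^ 3) (pfaffian (2 * t) (skewX F (2 * t))))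
    (F : Type) [Field F] [CharZero F] (n r : ℕ) (f : MvPolynomial (SkewVarIdx (2 * n)) F)
    (hf : f ∈ pfaffIdeal F n r) (hf0 : f ≠ 0) (h : MvPolynomial (SkewVarIdx (2 * n)) (LaurentSeries F))
    (hh : PolyOrdGE 1 (h - MvPolynomial.map (algebraMap F (LaurentSeries F)) f))
    (t : ℕ) (ht : c * t ^ 3 ≤ r) :
    DepthThreeOracleComputes h
      (MvPolynomial.map (algebraMap F (LaurentSeries F)) (pfaffian (2 * t) (skewX F (2 * t)))) :=
  AndrewsForbes2022_cor_4_5_of (AndrewsForbes2022_thm_4_4_of_prop_4_2 h42) hpf F n r f hf hf0 h hh t ht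


/-! #### Corollary 4.5 with the ABP hypothesis restricted to `t ≥ 1`

Erratum (t24, self-reported): the reductions `AndrewsForbes2022_cor_3_9_of` / `AndrewsForbes2022_cor_4_5_of`
(`AndrewsForbes2022DeterminantalIdeals.lean`) and `AndrewsForbes2022_cor_4_5_of_prop_4_2` above ask for
a layered ABP on `c · t³` vertices for EVERY `t`, including `t = 0`, where the target is the constant
`det_0 = Pf_0 = 1` and `LayeredABPComputes (c · 0³) 1 = LayeredABPComputes 0 1` is unsatisfiable (an
ABP has at least one vertex) — so those implications, while correct, have a hypothesis no ABP family
can meet.  The primed versions below restrict the hypothesis to `1 ≤ t` and treat `t = 0` by the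
trivial circuit `0 · h + 1`, exactly as `AndrewsForbes2022_cor_3_9_holds`
(`AndrewsForbes2022Cor39Proofs.lean`) does for the determinant.  The named facts `_cor_3_9` /
`_cor_4_5` themselves are unaffected. -/

/-- Cor. 4.5 (char 0) from Thm. 4.4 and a layered ABP with `c · t³` vertices for the `2t × 2t`
Pfaffian for every `t ≥ 1` ([MSV04, Thm. 12] in print, p0028:L74); `t = 0` (`Pf_0 = 1`) is the
trivial circuit. Supersedes `AndrewsForbes2022_cor_4_5_of`, whose hypothesis at `t = 0` is
unsatisfiable. [cite: AndrewsForbes2022, Cor. 4.5 (proof)] -/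
theorem AndrewsForbes2022_cor_4_5_of' (h44 : AndrewsForbes2022_thm_4_4) {c : ℕ}
    (hpf : ∀ (F : Type) [Field F] (t : ℕ), 1 ≤ t →
      LayeredABPComputes (c * t ^ 3) (pfaffian (2 * t) (skewX F (2 * t))))
    (F : Type) [Field F] [CharZero F] (n r : ℕ) (f : MvPolynomial (SkewVarIdx (2 * n)) F)
    (hf : f ∈ pfaffIdeal F n r) (hf0 : f ≠ 0) (h : MvPolynomial (SkewVarIdx (2 * n)) (LaurentSeries F))
    (hh : PolyOrdGE 1 (h - MvPolynomial.map (algebraMap F (LaurentSeries F)) f))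
    (t : ℕ) (ht : c * t ^ 3 ≤ r) :
    DepthThreeOracleComputes h
      (MvPolynomial.map (algebraMap F (LaurentSeries F)) (pfaffian (2 * t) (skewX F (2 * t)))) := by
  rcases Nat.eq_zero_or_pos t with rfl | htpos
  · have h1 : pfaffian (2 * 0) (skewX F (2 * 0)) = 1 := rfl
    refine ⟨0, fun _ => 0, 0, 1, fun _ => by rw [totalDegree_zero]; exact Nat.zero_le _, ?_⟩
    simp only [h1, map_one, map_zero, zero_mul, zero_add, sub_self]
    exact PolyOrdGE.zero 1
  · exact h44 F n r f hf hf0 h hh _ _ (InLayeredABPBorder.of_computes ((hpf F t htpos).mono ht))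

/-- Cor. 4.5 (char 0) conditional only on Prop. 4.2 and a `c · t³`-vertex Pfaffian ABP for `t ≥ 1`.
Supersedes `AndrewsForbes2022_cor_4_5_of_prop_4_2` (same erratum). [cite: AndrewsForbes2022, Cor. 4.5 (proof)] -/
theorem AndrewsForbes2022_cor_4_5_of_prop_4_2' (h42 : AndrewsForbes2022_prop_4_2) {c : ℕ}
    (hpf : ∀ (F : Type) [Field F] (t : ℕ), 1 ≤ t →
      LayeredABPComputes (c * t ^ 3) (pfaffian (2 * t) (skewX F (2 * t))))
    (F : Type) [Field F] [CharZero F] (n r : ℕ) (f : MvPolynomial (SkewVarIdx (2 * n)) F)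
    (hf : f ∈ pfaffIdeal F n r) (hf0 : f ≠ 0) (h : MvPolynomial (SkewVarIdx (2 * n)) (LaurentSeries F))
    (hh : PolyOrdGE 1 (h - MvPolynomial.map (algebraMap F (LaurentSeries F)) f))
    (t : ℕ) (ht : c * t ^ 3 ≤ r) :
    DepthThreeOracleComputes h
      (MvPolynomial.map (algebraMap F (LaurentSeries F)) (pfaffian (2 * t) (skewX F (2 * t)))) :=
  AndrewsForbes2022_cor_4_5_of' (AndrewsForbes2022_thm_4_4_of_prop_4_2 h42) hpf F n r f hf hf0 h hh t ht

/-- Likewise for the determinant: Cor. 3.9's shape from Thm. 3.8 and a `c · t³`-vertex det ABP for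
`t ≥ 1` (supersedes `AndrewsForbes2022_cor_3_9_of`; the unconditional `AndrewsForbes2022_cor_3_9_holds`
with `c = 2` is in `AndrewsForbes2022Cor39Proofs.lean`). [cite: AndrewsForbes2022, Cor. 3.9 (proof)] -/
theorem AndrewsForbes2022_cor_3_9_of' (h38 : AndrewsForbes2022_thm_3_8) {c : ℕ}
    (hdet : ∀ (F : Type) [Field F] (t : ℕ), 1 ≤ t → LayeredABPComputes (c * t ^ 3) (detPoly (Fin t) F))
    (F : Type) [Field F] [CharZero F] (n m r : ℕ) (f : MvPolynomial (Fin n × Fin m) F)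
    (hf : f ∈ detIdeal F n m r) (hf0 : f ≠ 0) (h : MvPolynomial (Fin n × Fin m) (LaurentSeries F))
    (hh : PolyOrdGE 1 (h - MvPolynomial.map (algebraMap F (LaurentSeries F)) f))
    (t : ℕ) (ht : c * t ^ 3 ≤ r) :
    DepthThreeOracleComputes h
      (MvPolynomial.map (algebraMap F (LaurentSeries F)) (detPoly (Fin t) F)) := by
  rcases Nat.eq_zero_or_pos t with rfl | htpos
  · have h1 : detPoly (Fin 0) F = 1 := by simp [detPoly]
    refine ⟨0, fun _ => 0, 0, 1, fun _ => by rw [totalDegree_zero]; exact Nat.zero_le _, ?_⟩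
    simp only [h1, map_one, map_zero, zero_mul, zero_add, sub_self]
    exact PolyOrdGE.zero 1
  · exact h38 F n m r f hf hf0 h hh _ _ (InLayeredABPBorder.of_computes ((hdet F t htpos).mono ht))

end Literature.Computability.AlgebraicComplexity
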